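import Literature.NumberTheory.EllipticCurves.GreenbergVatsal2000.CharacterPAdicLFunctionCProofs
import Literature.NumberTheory.EllipticCurves.GreenbergVatsal2000.CharacterLValueThreeEvalProofs
import Literature.NumberTheory.EllipticCurves.BernoulliDistributionRelationProofs
import HarnessLib

/-!
# Greenberg–Vatsal 2000, §3 p. 42: the `Σ₀`-DEPLETION of `L(C, T)` IS multiplication by the Euler
# factors — the interpolation value `characterLValueC p φ Σ₀ k` FACTORS as
# `∏_{ℓ∈Σ₀} (1 − χ_k(ℓ) ℓ^{k−1}) · (−(1/k) B_{k,χ_k})` with the PRIMITIVE-period Bernoulli number (THEOREMS)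

HONEST FRAMING (cell `bsd-eis`, seat `bsd-eis-x3` gen 5; FULL-BSD rank-`≤ 1` programme D-0033,
`run/shared/lean/pub/bsd-eis/README.md` §4): theorems only, no definition, no named fact; nothing is
booked. The tree DEFINES the value of the non-primitive `p`-adic `L`-function `L_{Σ₀}(C, T)` at
`T = κ(γ)^{k−1} − 1` (`CharacterPAdicLFunctions.lean`, `characterLValueC`) through the generalized
Bernoulli number of the `Σ₀ ∪ {p}`-IMPRIMITIVE character `χ_k · 1_{(·, pΣ₀) = 1}` summed over its period
`N = m · p · ∏_{ℓ∈Σ₀} ℓ` (Lang Ch. 2 §2 **B 7**). Greenberg–Vatsal describe the same object the other way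
round (p. 42): "To obtain the nonprimitive `p`-adic `L`-function `L_{Σ₀}(C, χ, T)`, one multiplies
`L(C, χ, T)` by the `l`-th Euler factors `1 − χψ⁻¹(l)(1 + T)^{f_l}` for each `l ∈ Σ₀`. … The value at
`T = ζ − 1` is the `l`-th Euler factor". This file PROVES that the two descriptions agree at the
interpolation points:

* `twistedBernoulli_mul_eq` — Lang **B 7** with the distribution relation **B 4**: the generalized
  Bernoulli number `B_{k,θ} = N^{k−1} ∑_{a<N} θ(a) B_k(a/N)` of an `N`-periodic `θ` does not change
  when the period `N` is replaced by a multiple `rN` (`k ≥ 1`; tree lemma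
  `sum_bernoulli_eval_fiber_eq`);
* `twistedBernoulli_deplete_prime` — removing the multiples of a prime `ℓ` from a completely
  multiplicative `N`-periodic `θ` multiplies `B_{k,θ}` by the Euler factor `1 − θ(ℓ) ℓ^{k−1}`
  (Möbius step: `θ·1_{ℓ∤·} = θ − θ·1_{ℓ∣·}` and `∑_{a<Nℓ, ℓ∣a} θ(a)B_k(a/(Nℓ)) = θ(ℓ)∑_{b<N} θ(b)B_k(b/N)`);
* `twistedBernoulli_depleted_eq_prod_mul` — induction over `Σ₀`:
  `B_{k, χ_k·1_{Σ₀}} = ∏_{v∈Σ₀}(1 − χ_k(ℓ_v) ℓ_v^{k−1}) · B_{k,χ_k}` with `B_{k,χ_k}` summed over `m·p`;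
* `characterLValueC_eq_prod_eulerFactor_mul` — **GV p. 42 as a theorem**:
  `characterLValueC p φ Σ₀ k = ∏_{v∈Σ₀}(1 − χ_k(ℓ_v) ℓ_v^{k−1}) · (−(1/k)·B_{k,χ_k})`, `χ_k = φω^{−k}`;
* `characterLValueC_three_eq_ratCast_eulerFactor` — the `p = 3` rational form with the SHORT period
  `3m` (the per-pair displays of `Summits/…/Additive/X3CertificateDisplay*.lean` evaluated the
  imprimitive sum over `3m∏ℓ` terms by `decide`; this form costs `3m` terms and `|Σ₀|` factors).

What this is NOT: no statement about `L_{Σ₀}(C, T)` as a power series (the Euler factors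
`1 − χψ⁻¹(l)(1+T)^{f_l} ∈ Λ` themselves and the additivity of `λ` are not treated here — only their
values at the interpolation points); nothing about the `D`-side (whose tree definition
`characterLValueD` already carries explicit Euler factors); `k ≥ 1` and `m ≥ 1` throughout.

References: [GreenbergVatsal2000] §3 pp. 41–42 ((26), "one multiplies `L(C, χ, T)` by the `l`-th Euler
factors"); [LangCyclotomic1990] Ch. 2 §2 (**B 4**, **B 7**), Ch. 4 §3 Thm. 3.2.
-/

noncomputable section

open scoped Classical

open Finset NumberField IsDedekindDomain Literature.NumberTheory.EllipticCurves

namespace Literature.NumberTheory.EllipticCurves.GreenbergVatsal2000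

variable (p : ℕ) [Fact p.Prime]

/-! ### §1 The generalized Bernoulli number does not depend on the period (Lang B 7 / B 4) -/

/-- A sum over `i < B·k` in `B` blocks of `k` consecutive indices. [folklore] -/
private theorem sum_range_mul_eq_sum_sum {M : Type*} [AddCommMonoid M] (f : ℕ → M) (B k : ℕ) :
    ∑ i ∈ range (B * k), f i = ∑ b ∈ range B, ∑ s ∈ range k, f (b * k + s) := by
  induction B with
  | zero => simp
  | succ B ih => rw [Nat.succ_mul, Finset.sum_range_add, ih, Finset.sum_range_succ]

variable {p} in
/-- An `N`-periodic function is invariant under `a ↦ a + jN`. [folklore] -/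
private theorem apply_add_mul_of_periodic {θ : ℕ → ℤ_[p]} {N : ℕ} (hθ : ∀ a, θ (a + N) = θ a)
    (a j : ℕ) : θ (a + j * N) = θ a := by
  induction j with
  | zero => rw [zero_mul, add_zero]
  | succ j ih => rw [Nat.succ_mul, ← add_assoc, hθ, ih]

/-- **Lang Ch. 2 §2, B 7 (with the distribution relation B 4): the generalized Bernoulli number
`B_{k,θ} = N^{k−1} ∑_{a<N} θ(a) B_k(a/N)` of an `N`-periodic function `θ` is unchanged when the period
`N` is replaced by a multiple `rN`** (`k ≥ 1`). [cite: LangCyclotomic1990, Ch. 2 §2, B 4 and B 7 (PDF pp. 34–35)] -/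
theorem twistedBernoulli_mul_eq {k : ℕ} (hk : 1 ≤ k) {N r : ℕ} (hN : 0 < N) (hr : 0 < r)
    (θ : ℕ → ℤ_[p]) (hθ : ∀ a, θ (a + N) = θ a) :
    twistedBernoulli p k (r * N) θ = twistedBernoulli p k N θ := by
  unfold twistedBernoulli
  rw [mul_sum, mul_sum, sum_range_mul_eq_sum_sum _ r N, sum_comm]
  refine sum_congr rfl fun s _ ↦ ?_
  have hθs : ∀ j, θ (j * N + s) = θ s := fun j ↦ by
    rw [add_comm]; exact apply_add_mul_of_periodic hθ s j
  have h := sum_bernoulli_eval_fiber_eq hk hr hN s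
  have h' := congrArg (fun q : ℚ ↦ (q : ℚ_[p])) h
  simp only [Rat.cast_sum, Rat.cast_mul, Rat.cast_pow, Rat.cast_natCast] at h'
  calc ∑ j ∈ range r, ((r * N : ℕ) : ℚ_[p]) ^ (k - 1) *
          (((θ (j * N + s) : ℤ_[p]) : ℚ_[p]) *
            (((Polynomial.bernoulli k).eval (((j * N + s : ℕ) : ℚ) / ((r * N : ℕ) : ℚ)) : ℚ) : ℚ_[p]))
      = ((θ s : ℤ_[p]) : ℚ_[p]) * ∑ j ∈ range r, ((r * N : ℕ) : ℚ_[p]) ^ (k - 1) *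
          (((Polynomial.bernoulli k).eval (((s + j * N : ℕ) : ℚ) / ((r * N : ℕ) : ℚ)) : ℚ) : ℚ_[p]) := by
        rw [mul_sum]
        refine sum_congr rfl fun j _ ↦ ?_
        rw [hθs j, Nat.add_comm (j * N) s]
        ring
    _ = (N : ℚ_[p]) ^ (k - 1) *
          (((θ s : ℤ_[p]) : ℚ_[p]) * (((Polynomial.bernoulli k).eval ((s : ℚ) / (N : ℚ)) : ℚ) : ℚ_[p])) := by
        rw [h']
        ring

/-! ### §2 Removing the multiples of one prime: the Euler factor -/

/-- `∑_{a<Nℓ} [ℓ ∣ a] f(a) = ∑_{b<N} f(bℓ)` (`ℓ ≥ 1`). [folklore] -/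
private theorem sum_range_mul_ite_dvd {M : Type*} [AddCommMonoid M] (f : ℕ → M) {ℓ : ℕ}
    (hℓ : 0 < ℓ) (N : ℕ) :
    ∑ a ∈ range (N * ℓ), (if ℓ ∣ a then f a else 0) = ∑ b ∈ range N, f (b * ℓ) := by
  rw [sum_range_mul_eq_sum_sum _ N ℓ]
  refine sum_congr rfl fun b _ ↦ ?_
  rw [Finset.sum_eq_single_of_mem 0 (mem_range.mpr hℓ)]
  · rw [add_zero, if_pos (dvd_mul_left ℓ b)]
  · intro s hs hs0
    rw [if_neg]
    intro h
    have hs' : ℓ ∣ s := (Nat.dvd_add_right (dvd_mul_left ℓ b)).mp h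
    exact hs0 (Nat.eq_zero_of_dvd_of_lt hs' (mem_range.mp hs))

/-- **The Möbius step of GV p. 42 / Lang Ch. 2 §2**: for an `N`-periodic, completely multiplicative
`θ` and `ℓ ≥ 1`, deleting the multiples of `ℓ` (period `Nℓ`) multiplies the generalized Bernoulli
number by the EULER FACTOR: `B_{k, θ·1_{ℓ∤·}} = (1 − θ(ℓ) ℓ^{k−1}) · B_{k,θ}` (`k ≥ 1`) — "The value at
`T = ζ − 1` is the `l`-th Euler factor" (GV p. 42) at the point `s = 1 − k`.
[cite: GreenbergVatsal2000, §3 p. 42 (Σ₀-depletion = multiplication by the Euler factors)]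
[cite: LangCyclotomic1990, Ch. 2 §2, B 4 and B 7 (PDF pp. 34–35)] -/
theorem twistedBernoulli_deplete_prime {k : ℕ} (hk : 1 ≤ k) {N ℓ : ℕ} (hN : 0 < N) (hℓ : 0 < ℓ)
    (θ : ℕ → ℤ_[p]) (hθ : ∀ a, θ (a + N) = θ a) (hmul : ∀ b, θ (b * ℓ) = θ b * θ ℓ) :
    twistedBernoulli p k (N * ℓ) (fun a ↦ if ℓ ∣ a then 0 else θ a) =
      (1 - ((θ ℓ : ℤ_[p]) : ℚ_[p]) * (ℓ : ℚ_[p]) ^ (k - 1)) * twistedBernoulli p k N θ := by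
  have hper := twistedBernoulli_mul_eq p hk hN hℓ θ hθ
  unfold twistedBernoulli at hper ⊢
  rw [mul_comm ℓ N] at hper
  -- split the depleted summand: `[ℓ ∤ a] θ(a) = θ(a) − [ℓ ∣ a] θ(a)`
  have hsplit : ∀ a : ℕ, (((if ℓ ∣ a then 0 else θ a : ℤ_[p]) : ℚ_[p]) *
        (((Polynomial.bernoulli k).eval ((a : ℚ) / ((N * ℓ : ℕ) : ℚ)) : ℚ) : ℚ_[p])) =
      ((θ a : ℤ_[p]) : ℚ_[p]) * (((Polynomial.bernoulli k).eval ((a : ℚ) / ((N * ℓ : ℕ) : ℚ)) : ℚ) : ℚ_[p]) -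
        (if ℓ ∣ a then ((θ a : ℤ_[p]) : ℚ_[p]) *
          (((Polynomial.bernoulli k).eval ((a : ℚ) / ((N * ℓ : ℕ) : ℚ)) : ℚ) : ℚ_[p]) else 0) := by
    intro a
    split_ifs with h
    · simp
    · simp
  rw [sum_congr rfl (fun a _ ↦ hsplit a), sum_sub_distrib, sum_range_mul_ite_dvd _ hℓ N, mul_sub, hper]
  -- the second sum: `∑_{b<N} θ(bℓ) B_k(bℓ/(Nℓ)) = θ(ℓ) ∑_{b<N} θ(b) B_k(b/N)`
  have hNℓ : ((N * ℓ : ℕ) : ℚ) ≠ 0 := by positivity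
  have hℓ0 : (ℓ : ℚ) ≠ 0 := by exact_mod_cast hℓ.ne'
  have hterm : ∀ b : ℕ, ((θ (b * ℓ) : ℤ_[p]) : ℚ_[p]) *
        (((Polynomial.bernoulli k).eval (((b * ℓ : ℕ) : ℚ) / ((N * ℓ : ℕ) : ℚ)) : ℚ) : ℚ_[p]) =
      ((θ ℓ : ℤ_[p]) : ℚ_[p]) * (((θ b : ℤ_[p]) : ℚ_[p]) *
        (((Polynomial.bernoulli k).eval ((b : ℚ) / (N : ℚ)) : ℚ) : ℚ_[p])) := by
    intro b
    have hq : ((b * ℓ : ℕ) : ℚ) / ((N * ℓ : ℕ) : ℚ) = (b : ℚ) / (N : ℚ) := by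
      push_cast
      field_simp
    rw [hmul b, hq]
    push_cast
    ring
  rw [sum_congr rfl (fun b _ ↦ hterm b), ← mul_sum]
  obtain ⟨k, rfl⟩ := Nat.exists_eq_add_of_le hk
  rw [show 1 + k - 1 = k from by omega]
  push_cast
  ring

/-! ### §3 Induction over `Σ₀`: the `Σ₀`-imprimitive Bernoulli number is the Euler product times the
`p`-imprimitive one -/

section Character

variable {m : ℕ} (φ : DirichletCharacter (ZMod p) m) (S₀ : Finset (HeightOneSpectrum (𝓞 ℚ)))

/-- Distinct finite places of `ℚ` lie over distinct primes. [folklore] -/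
private theorem natGenerator_injective' :
    Function.Injective (Rat.HeightOneSpectrum.natGenerator (R := 𝓞 ℚ)) := fun _ _ h ↦
  (Rat.HeightOneSpectrum.primesEquiv (R := 𝓞 ℚ)).injective (Subtype.ext h)

/-- The period `m·p·∏_{w∈Σ₀} ℓ_w` of the `Σ₀ ∪ {p}`-imprimitive character is positive (`m ≥ 1`;
Lang **B 7**: "Let `N` be a positive integer"). [cite: LangCyclotomic1990, Ch. 2 §2 (B 7: the period N)] -/
theorem depletedModulus_pos (hm : 0 < m) : 0 < depletedModulus p S₀ m := by
  unfold depletedModulus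
  exact Nat.mul_pos (Nat.mul_pos hm (Fact.out : p.Prime).pos)
    (Finset.prod_pos fun v _ ↦ (Rat.HeightOneSpectrum.prime_natGenerator v).pos)

omit [Fact p.Prime] in
/-- Inserting a place `v ∉ Σ₀` multiplies the period `m·p·∏ℓ` by `ℓ_v` (Lang **B 7**, the period of
the imprimitive character). [cite: LangCyclotomic1990, Ch. 2 §2 (B 7: the period N)] -/
theorem depletedModulus_insert {v : HeightOneSpectrum (𝓞 ℚ)} (hv : v ∉ S₀) :
    depletedModulus p (insert v S₀) m =
      depletedModulus p S₀ m * Rat.HeightOneSpectrum.natGenerator v := by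
  unfold depletedModulus
  rw [Finset.prod_insert hv]
  ring

/-- Inserting a place `v` into `Σ₀` deletes the multiples of `ℓ_v` from the depleted character.
[cite: GreenbergVatsal2000, §3 p. 42 (Σ₀-depletion)] -/
theorem depletedEvenCharacterTwist_insert (k : ℕ) (v : HeightOneSpectrum (𝓞 ℚ)) (a : ℕ) :
    depletedEvenCharacterTwist p φ (insert v S₀) k a =
      if Rat.HeightOneSpectrum.natGenerator v ∣ a then 0
      else depletedEvenCharacterTwist p φ S₀ k a := by
  unfold depletedEvenCharacterTwist
  simp only [Finset.exists_mem_insert]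
  by_cases h : Rat.HeightOneSpectrum.natGenerator v ∣ a
  · rw [if_pos (Or.inl h), if_pos h]
  · rw [if_neg h]
    by_cases h' : ∃ w ∈ S₀, Rat.HeightOneSpectrum.natGenerator w ∣ a
    · rw [if_pos (Or.inr h'), if_pos h']
    · rw [if_neg h', if_neg (by rintro (h₁ | h₁); exacts [h h₁, h' h₁])]

/-- For `v ∉ Σ₀` the `Σ₀`-depleted character takes the undepleted value `χ_k(ℓ_v)` at `ℓ_v`
(no prime of `Σ₀` divides the prime `ℓ_v`): the coefficient `χψ⁻¹(l)` of GV's Euler factor is the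
PRIMITIVE character's value. [cite: GreenbergVatsal2000, §3 p. 42 (the l-th Euler factor 1 − χψ⁻¹(l)(1+T)^{f_l})] -/
theorem depletedEvenCharacterTwist_natGenerator_of_not_mem (k : ℕ) {v : HeightOneSpectrum (𝓞 ℚ)}
    (hv : v ∉ S₀) :
    depletedEvenCharacterTwist p φ S₀ k (Rat.HeightOneSpectrum.natGenerator v) =
      evenCharacterTwist p φ k (Rat.HeightOneSpectrum.natGenerator v) := by
  unfold depletedEvenCharacterTwist
  rw [if_neg]
  rintro ⟨w, hw, hdvd⟩
  have heq : Rat.HeightOneSpectrum.natGenerator w = Rat.HeightOneSpectrum.natGenerator v :=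
    (Nat.prime_dvd_prime_iff_eq (Rat.HeightOneSpectrum.prime_natGenerator w)
      (Rat.HeightOneSpectrum.prime_natGenerator v)).mp hdvd
  exact hv (natGenerator_injective' heq ▸ hw)

/-- **GV p. 42 for the generalized Bernoulli numbers: the `Σ₀ ∪ {p}`-imprimitive number (period
`m·p·∏ℓ`) is the Euler product `∏_{v∈Σ₀}(1 − χ_k(ℓ_v) ℓ_v^{k−1})` times the `p`-imprimitive number
`B_{k,χ_k}` (period `m·p`)**, `χ_k = φω^{−k}`, `k ≥ 1`, `m ≥ 1`.
[cite: GreenbergVatsal2000, §3 p. 42 (Σ₀-depletion = multiplication by the Euler factors)]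
[cite: LangCyclotomic1990, Ch. 2 §2, B 4 and B 7 (PDF pp. 34–35)] -/
theorem twistedBernoulli_depleted_eq_prod_mul {k : ℕ} (hk : 1 ≤ k) (hm : 0 < m) :
    twistedBernoulli p k (depletedModulus p S₀ m) (depletedEvenCharacterTwist p φ S₀ k) =
      (∏ v ∈ S₀, (1 - ((evenCharacterTwist p φ k (Rat.HeightOneSpectrum.natGenerator v) : ℤ_[p]) :
          ℚ_[p]) * ((Rat.HeightOneSpectrum.natGenerator v : ℕ) : ℚ_[p]) ^ (k - 1))) *
        twistedBernoulli p k (m * p) (evenCharacterTwist p φ k) := by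
  induction S₀ using Finset.induction_on with
  | empty =>
    have h1 : depletedModulus p (∅ : Finset (HeightOneSpectrum (𝓞 ℚ))) m = m * p := by
      unfold depletedModulus; rw [prod_empty, mul_one]
    have h2 : depletedEvenCharacterTwist p φ (∅ : Finset (HeightOneSpectrum (𝓞 ℚ))) k =
        evenCharacterTwist p φ k := by
      funext a
      unfold depletedEvenCharacterTwist
      rw [if_neg (by simp)]
    rw [h1, h2, prod_empty, one_mul]
  | insert v S hv ih =>
    have hN : 0 < depletedModulus p S m := depletedModulus_pos p S hm
    have hℓ : 0 < Rat.HeightOneSpectrum.natGenerator v := (Rat.HeightOneSpectrum.prime_natGenerator v).pos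
    have hfun : depletedEvenCharacterTwist p φ (insert v S) k =
        fun a ↦ if Rat.HeightOneSpectrum.natGenerator v ∣ a then 0
          else depletedEvenCharacterTwist p φ S k a := by
      funext a; exact depletedEvenCharacterTwist_insert p φ S k v a
    rw [depletedModulus_insert p S hv, hfun,
      twistedBernoulli_deplete_prime p hk hN hℓ _ (depletedEvenCharacterTwist_add_depletedModulus p φ S k)
        (fun b ↦ depletedEvenCharacterTwist_mul p φ S k b _),
      depletedEvenCharacterTwist_natGenerator_of_not_mem p φ S k hv, ih, prod_insert hv, mul_assoc]

/-- **Greenberg–Vatsal 2000, p. 42, at the interpolation points (THEOREM): the value of the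
non-primitive `p`-adic `L`-function `L_{Σ₀}(C, T)` at `T = κ(γ)^{k−1} − 1` is the product of the
`Σ₀`-Euler factors `1 − χ_k(ℓ) ℓ^{k−1}` ("the `l`-th Euler factor `1 − χψ⁻¹ρ(l)` in `L(χψ⁻¹ρ, s)`",
here `ρ ↔ s = 1 − k`) and the value `−(1/k)·B_{k,χ_k}` of the `p`-adic `L`-function of the character
`φ = ωψ⁻¹` (Lang Ch. 4 Thm. 3.2)**, `χ_k = φω^{−k}` on integers prime to `p`, `k ≥ 1`, `m ≥ 1`.
[cite: GreenbergVatsal2000, §3 pp. 41–42 ((26); "To obtain the nonprimitive p-adic L-function L_{Σ₀}(C,χ,T), one multiplies L(C,χ,T) by the l-th Euler factors … The value at T = ζ − 1 is the l-th Euler factor")]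
[cite: LangCyclotomic1990, Ch. 4 §3 Thm. 3.2 (L_p(1−k,χ) = −B_{k,χω^{−k}}/k) and Ch. 2 §2 (B 4, B 7)] -/
theorem characterLValueC_eq_prod_eulerFactor_mul {k : ℕ} (hk : 1 ≤ k) (hm : 0 < m) :
    characterLValueC p φ S₀ k =
      (∏ v ∈ S₀, (1 - ((evenCharacterTwist p φ k (Rat.HeightOneSpectrum.natGenerator v) : ℤ_[p]) :
          ℚ_[p]) * ((Rat.HeightOneSpectrum.natGenerator v : ℕ) : ℚ_[p]) ^ (k - 1))) *
        (-(1 / (k : ℚ_[p])) * twistedBernoulli p k (m * p) (evenCharacterTwist p φ k)) := by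
  unfold characterLValueC
  rw [twistedBernoulli_depleted_eq_prod_mul p φ S₀ hk hm]
  ring

end Character

/-! ### §4 `p = 3`: the short rational form (period `3m`, `|Σ₀|` Euler factors) -/

section Three

variable {m : ℕ} (φ : DirichletCharacter (ZMod 3) m) (S₀ : Finset (HeightOneSpectrum (𝓞 ℚ)))

/-- The undepleted even twist at `p = 3`, read in `ℚ₃`, is the cast of the integer
`t_k(a) = [3 ∤ a] · lift(φ(a)·(a⁻¹)^k) ∈ {0, 1, −1}`. [cite: LangCyclotomic1990, Ch. 1 §2 (the Teichmüller character) and Ch. 10 §2 (χ_k = χω^{−k})] -/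
theorem coe_evenCharacterTwist_three (k a : ℕ) :
    ((evenCharacterTwist 3 φ k a : ℤ_[3]) : ℚ_[3]) =
      ((if 3 ∣ a then 0 else
        (if φ (a : ZMod m) * ((a : ZMod 3)⁻¹) ^ k = 0 then 0
          else if φ (a : ZMod m) * ((a : ZMod 3)⁻¹) ^ k = 1 then 1 else -1) : ℤ) : ℚ_[3]) := by
  unfold evenCharacterTwist
  by_cases h3 : 3 ∣ a
  · rw [if_pos h3, if_pos h3]; simp
  rw [if_neg h3, if_neg h3, coe_teichmullerLift_three]

/-- **`characterLValueC 3 φ Σ₀ k` as an explicit rational number in the SHORT form** (`k ≥ 1`,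
`m ≥ 1`): `∏_{v∈Σ₀}(1 − t_k(ℓ_v)·ℓ_v^{k−1}) · (−(1/k)·(3m)^{k−1}·∑_{a<3m} t_k(a)·B_k(a/(3m)))` with the
integer `t_k` of `coe_evenCharacterTwist_three` — GV p. 42's Euler factors times Lang's `B_{k,χ_k}`
over the period `3m`; a display evaluates it by `decide` in `3m + |Σ₀|` steps instead of the
`3m∏ℓ` steps of `characterLValueC_three_eq_ratCast`. [cite: GreenbergVatsal2000, §3 pp. 41–42 ((26) and the Σ₀-Euler factors)]
[cite: LangCyclotomic1990, Ch. 2 §2 (B 7) and Ch. 4 §3 Thm. 3.2] -/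
theorem characterLValueC_three_eq_ratCast_eulerFactor {k : ℕ} (hk : 1 ≤ k) (hm : 0 < m) :
    characterLValueC 3 φ S₀ k =
      (((∏ v ∈ S₀,
          (1 - ((if 3 ∣ Rat.HeightOneSpectrum.natGenerator v then 0 else
              (if φ (Rat.HeightOneSpectrum.natGenerator v : ZMod m) *
                    ((Rat.HeightOneSpectrum.natGenerator v : ZMod 3)⁻¹) ^ k = 0 then 0
                else if φ (Rat.HeightOneSpectrum.natGenerator v : ZMod m) *
                    ((Rat.HeightOneSpectrum.natGenerator v : ZMod 3)⁻¹) ^ k = 1 then 1 else -1) : ℤ) : ℚ) *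
            ((Rat.HeightOneSpectrum.natGenerator v : ℕ) : ℚ) ^ (k - 1))) *
        (-(1 / (k : ℚ)) * (((m * 3 : ℕ) : ℚ) ^ (k - 1) *
          ∑ a ∈ Finset.range (m * 3),
            ((if 3 ∣ a then 0 else
              (if φ (a : ZMod m) * ((a : ZMod 3)⁻¹) ^ k = 0 then 0
                else if φ (a : ZMod m) * ((a : ZMod 3)⁻¹) ^ k = 1 then 1 else -1) : ℤ) : ℚ) *
              (Polynomial.bernoulli k).eval ((a : ℚ) / ((m * 3 : ℕ) : ℚ)))) : ℚ) : ℚ_[3]) := by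
  rw [characterLValueC_eq_prod_eulerFactor_mul 3 φ S₀ hk hm]
  unfold twistedBernoulli
  rw [Finset.sum_congr rfl (fun a _ ↦ by rw [coe_evenCharacterTwist_three φ k a]),
    Finset.prod_congr rfl (fun v _ ↦ by rw [coe_evenCharacterTwist_three φ k])]
  simp only [Rat.cast_mul, Rat.cast_neg, Rat.cast_div, Rat.cast_one, Rat.cast_natCast, Rat.cast_pow,
    Rat.cast_sum, Rat.cast_prod, Rat.cast_intCast, Rat.cast_sub]

end Three

end Literature.NumberTheory.EllipticCurves.GreenbergVatsal2000

end
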